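import Literature.Topology.FourManifolds.LatticeFormsGeneralDivisorDiscriminantGroup
import HarnessLib

/-!
# `D((h_d)^⊥) = D(L_B)`: the discriminant form of the orthogonal complement of a vector of general divisor `f`
# in `L_{2t}` (Gritsenko–Hulek–Sankaran, *Compositio Math.* 146 (2010), §4, proof of Prop. 4.12)

Trunk T-4MAN vocabulary; sequel of `LatticeFormsGeneralDivisorDiscriminantGroup.lean` (row g45-#5: the discriminant
group `D(L_B)` of the rank-two lattice `L_B`, `B = (−2b, a; a, −2t)` of Prop. 4.6 (iv): the classes `k̄₁ = [ε₀]`,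
`k̄₃ = [fε₁ − cε₀]`, their orders `2d/f`, `2t/f`, `k̄₁·k̄₃ = 0`, `k̄₃² = −f²/2t`, `|D(L_B)| = (2d/f)(2t/f)`, and
`D(L_B) = ⟨k̄₁⟩ ⊕ ⟨k̄₃⟩` for `w = 1`) and of `LatticeFormsPolarisationTypesGeneralDivisor.lean` (row g43-#2:
`restrict_orthogonal_model_equivalent_of_divisor`, "`(h_d)^⊥_{L_{2t}} ≅ 2U ⊕ 2E₈(−1) ⊕ B`" for the models
`(E₈(−1)^{⊕m} ⊕ U^{⊕(n+2)}) ⊕ ℤ(−2t)`). This file performs the step "`D(L_B) = D((h_d)^⊥_{L_{2t}})` (see (LB))" of the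
printed proof: the even unimodular summand `2U ⊕ 2E₈(−1)` does not contribute to the discriminant form, so everything
proved for `D(L_B)` holds for `D((h_d)^⊥)`. Written for lane `lit-hodgefound` (Track 2 foundations; prover seat
`lit-hodgefound-p18`, gen 45, row g45-#6). THEOREMS ONLY — no definition, no named fact, no instance, no notation.

## Source, verbatim (V. Gritsenko, K. Hulek, G. K. Sankaran, Compositio Math. 146 (2010) 404–434, arXiv numbering §4,
held text `paper:arxiv-0802.2078` p. 12, proof of Prop. 4.12)

"We may take `h_d` in the form (hd). We can fix a basis `k₁, k₂` of `L_B^∨` given by `k₁ = (f/2d)h_d − e₂`,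
`k₂ = (c/2d)h_d + (1/2t)l_t`. Up to sign, this is dual to the basis fixed in (LB). We put `k₃ = fk₂ − ck₁ = ce₂ + (f/2t)l_t`.
If `v ∈ L^∨` we shall denote by `v̄` the corresponding element in the discriminant group `D(L) = L^∨/L`. We note that the
orders of `k̄₁` and of `k̄₃` in `D(L_B) = D((h_d)^⊥_{L_{2t}})` (see (LB)) are equal to `2d/f` and `2t/f` respectively.
Moreover `k̄₁·k̄₃ = 0`. […] It follows that `k̄₁` and `k̄₃` form a basis of `D(L_B)` if `w = 1`. […] where
`h_d^⊥ = (h_d)^⊥_{L_{2t}} ≅ 2U ⊕ 2E₈(−1) ⊕ L_B`. […] It follows if `w = 1` the discriminant group is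
`D(h_d^⊥) = ⟨k̄₁⟩ ⊕ ⟨k̄₃⟩ = p(H) ⊕ ⟨k̄₃⟩`. […] where `⟨k̄₃⟩ = {nk̄₃ | n mod 2t/f}` and `k̄₃² ≡ −f²/2t mod 2`."

V. V. Nikulin, Math. USSR Izv. 14 (1980), §1.3: the discriminant form of an orthogonal sum is the orthogonal sum of the
discriminant forms, and a unimodular lattice has trivial discriminant form (the tree's `discriminantGroupProdEquiv`,
`discriminantQuad_discriminantGroupProdEquiv`, `subsingleton_discriminantGroup`, Huybrechts Ch. 14 §0.1–0.2).

## Reading notes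

* "`D(L_B) = D((h_d)^⊥)`" is an identification along the isometry (LB); formally it is an ISOMORPHISM of finite
  quadratic forms `(A_{(h_d)^⊥}, b, q) ≅ (A_{L_B}, b, q)`, obtained (§1) from any isometry `Λ ≅ P ⊕ Q` with `P` even
  unimodular: `A_Λ ≅ A_{P ⊕ Q} ≅ A_P × A_Q` and `A_P = 0`. The printed elements `k̄₁, k̄₃ ∈ D((h_d)^⊥)` are rendered
  as the images `κ₁, κ₃` of `[ε₀], [fε₁ − cε₀] ∈ D(L_B)` under such an isomorphism; their orders, products and squares
  are those computed in `LatticeFormsGeneralDivisorDiscriminantGroup.lean`.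
* As in the g43 file, the complement is available in the tree for the MODELS `(E₈(−1)^{⊕m} ⊕ U^{⊕(n+2)}) ⊕ ℤ(−2t)`
  (`L_{2t}`: `m = 2`, `n = 1`) and for every primitive `h` with `h² = 2d`, `(h, L) = fℤ` (not only the representative
  (hd)); `c = h.2` is the `l_t`-coordinate, `f²b = d + tc²`, `fa = 2tc`, `fD' = 2d`, `fT' = 2t`. "`(c, f) = 1`" is a
  hypothesis `Int.gcd f c = 1` (it follows from primitivity, `gcd_snd_eq_one_of_primitive_of_forall_dvd`; the
  `_of_primitive` corollary takes primitivity instead). `d ≠ 0` is needed for nondegeneracy; `2d > 0` is not used.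
* Everything is first proved (§2) for an ARBITRARY lattice `Λ` with `Λ ≅ P ⊕ L_B`, `P` even unimodular — the shape of
  Prop. 4.6 (iv) — so that it applies verbatim to `(h_d)^⊥` in the models (§3) and in the lattices of record
  (`k3Hilbert_/kum_restrict_orthogonal_equivalent_of_divisor`). The hypotheses `hN`, `hS`, `hE` (nondegenerate,
  symmetric, even) are arbitrary proof terms (the values of `b` and `q` do not depend on them); for the models they are
  supplied by `nondegenerate_restrict_orthogonal_model_of_divisor`, `isSymm_/isEven_restrict_orthogonal_model`.

## Contents (all proved)

* §1 transport: `exists_discriminantGroup_linearEquiv_prod_of_isUnimodular_left` (`A_Q ⥲ A_{P ⊕ Q}` for `P`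
  unimodular), `nonempty_discriminantGroup_linearEquiv_of_equivalent_prod_of_isUnimodular`,
  **`exists_discriminantQuad_isometry_of_equivalent_prod_of_isUnimodular`** (`Λ ≅ P ⊕ Q`, `P` even unimodular ⟹
  `(A_Λ, b, q) ≅ (A_Q, b, q)`).
* §2 a lattice `Λ ≅ P ⊕ L_B` with `P` even unimodular (the shape in which `(h_d)^⊥` is known):
  `natCard_discriminantGroup_of_equivalent_prod_generalDivisorGram` (`|A_Λ| = (2d/f)(2t/f)`),
  **`exists_discriminantQuad_isometry_of_equivalent_prod_generalDivisorGram`** (`(A_Λ, b, q) ≅ (A_{L_B}, b, q)`),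
  **`exists_generators_discriminantGroup_of_equivalent_prod_generalDivisorGram`** (`κ₁, κ₃ ∈ A_Λ` of orders exactly
  `2d/f`, `2t/f`, `b(κ₁, κ₃) = 0`, `q(κ₁) = −f²/2d`, `q(κ₃) = −f²/2t`, generating when `(f, 2t/f) = 1`),
  **`exists_discriminantGroup_addEquiv_zmod_prod_zmod_of_equivalent_prod_generalDivisorGram`** (`w = 1`:
  `A_Λ = ⟨κ₁⟩ ⊕ ⟨κ₃⟩ ≅ ℤ/(2d/f) × ℤ/(2t/f)`, `κ₁ ↦ (1, 0)`, `κ₃ ↦ (0, 1)`, with the values of `b` and `q`),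
  `nonempty_discriminantGroup_addEquiv_zmod_prod_zmod_of_equivalent_prod_generalDivisorGram`.
* §3 the models `(E₈(−1)^{⊕m} ⊕ U^{⊕(n+2)}) ⊕ ℤ(−2t)`, every primitive `h` with `h² = 2d ≠ 0`, `(h, L) = fℤ`:
  `isSymm_/isEven_restrict_orthogonal_model`, `nondegenerate_restrict_orthogonal_model_of_divisor`,
  **`exists_discriminantQuad_isometry_restrict_orthogonal_model_of_divisor`** (`(A_{h^⊥}, b, q) ≅ (A_{L_B}, b, q)`),
  `nonempty_discriminantGroup_restrict_orthogonal_model_linearEquiv_of_divisor`,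
  `natCard_discriminantGroup_restrict_orthogonal_model_of_divisor` (`|D(h^⊥)| = (2d/f)(2t/f)`),
  **`exists_generators_discriminantGroup_restrict_orthogonal_model_of_divisor`**,
  **`exists_discriminantGroup_restrict_orthogonal_model_addEquiv_zmod_prod_zmod`** (`w = 1`:
  `D(h^⊥) = ⟨κ₁⟩ ⊕ ⟨κ₃⟩ ≅ ℤ/(2d/f) × ℤ/(2t/f)`), `nonempty_discriminantGroup_restrict_orthogonal_model_addEquiv_zmod_prod_zmod`
  and its `_of_primitive` form.
* §4 Remarks 4.14/4.15 (row g45-#8): `int_gcd_dvd_of_divisor_data` (`(f, 2t/f) ∣ 2d/f`), `int_gcd_eq_one_of_int_gcd_eq_one`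
  (`g₁ = 1 ⟹ w = 1`), **`int_gcd_eq_one_of_squarefree_two_mul`**, **`int_gcd_eq_one_of_squarefree_int_gcd`** (Remark 4.14),
  **`nonempty_discriminantGroup_addEquiv_zmod_mul_of_equivalent_prod_generalDivisorGram`** and
  `nonempty_discriminantGroup_restrict_orthogonal_model_addEquiv_zmod_mul` (Remark 4.15, first sentence: `g₁ = 1 ⟹ D(h^⊥)`
  cyclic `≅ ℤ/(4dt/f²)`), and the scope note on its middle sentence: `zsmul_mk_proj_one_generalDivisorGram_nine_eq_zero_iff`,
  **`nonempty_discriminantGroup_generalDivisorGram_nine_addEquiv_zmod`** (`D(L_B) ≅ ℤ/27` cyclic for `B = (−2, 3; 3, −18)`,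
  `g₁ = 3`), **`exists_divisor_six_discriminantGroup_restrict_orthogonal_addEquiv_zmod_twentySeven`** (a primitive
  `h_27 ∈ L_18` with `div = 6` and `D(h^⊥) ≅ ℤ/27`).

## References

* [GritsenkoHulekSankaran2010Symplectic] V. Gritsenko, K. Hulek, G. K. Sankaran, Moduli spaces of irreducible symplectic
  manifolds, Compositio Math. 146 (2010) 404–434 (arXiv:0802.2078): §4 Prop. 4.6 (iv), proof of Prop. 4.12, Remark 4.15.
* [Nikulin1980] V. V. Nikulin, Integral symmetric bilinear forms and some of their applications, Math. USSR Izv. 14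
  (1980) 103–167: §1.3.
* [Huybrechts2016K3] D. Huybrechts, Lectures on K3 surfaces, CUP 2016: Ch. 14 §0.1–0.2.
-/

noncomputable section

open Module Function
open LinearMap (BilinForm)
open LinearMap.BilinForm

namespace Literature.Topology.FourManifolds

universe u

/-! ### §1 `A_Λ ≅ A_Q` compatibly with `b` and `q` when `Λ ≅ P ⊕ Q` with `P` even unimodular -/

section Transport

variable {N : Type*} {P₁ : Type*} {P₂ : Type*} [AddCommGroup N] [AddCommGroup P₁] [AddCommGroup P₂]
  {B : BilinForm ℤ N} {P : BilinForm ℤ P₁} {Q : BilinForm ℤ P₂}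

/-- **`A_Q ⥲ A_{P ⊕ Q}`, `a ↦ Ψ(0, a)`, for `P` unimodular**: `A_{P ⊕ Q} ≅ A_P × A_Q` and `A_P = 0` ("a unimodular
lattice has trivial discriminant group"). [cite: Nikulin1980, §1.3] [cite: Huybrechts2016K3, Ch. 14 §0.1–0.2] -/
theorem exists_discriminantGroup_linearEquiv_prod_of_isUnimodular_left (hP : P.IsUnimodular) :
    ∃ ι : Q.discriminantGroup ≃ₗ[ℤ] (P.prod Q).discriminantGroup, ∀ a, ι a = P.discriminantGroupProdEquiv Q (0, a) := by
  haveI : P.IsPerfPair := hP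
  haveI : Subsingleton P.discriminantGroup := P.subsingleton_discriminantGroup
  let j : Q.discriminantGroup →ₗ[ℤ] (P.prod Q).discriminantGroup :=
    (P.discriminantGroupProdEquiv Q).toLinearMap ∘ₗ LinearMap.inr ℤ _ _
  have hj : Function.Bijective j := by
    refine ⟨(P.discriminantGroupProdEquiv Q).injective.comp LinearMap.inr_injective, fun c ↦ ?_⟩
    obtain ⟨⟨a, b⟩, rfl⟩ := (P.discriminantGroupProdEquiv Q).surjective c
    exact ⟨b, by rw [Subsingleton.elim a 0]; rfl⟩
  exact ⟨LinearEquiv.ofBijective j hj, fun a ↦ by rw [LinearEquiv.ofBijective_apply]; rfl⟩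

/-- **`Λ ≅ P ⊕ Q` with `P` unimodular ⟹ `A_Λ ≅ A_Q`** (as groups; `A_Λ ≅ A_{P ⊕ Q}` along the isometry, then §1).
[cite: Nikulin1980, §1.3] [cite: Huybrechts2016K3, Ch. 14 §0.1–0.2] -/
theorem nonempty_discriminantGroup_linearEquiv_of_equivalent_prod_of_isUnimodular (h : B.Equivalent (P.prod Q))
    (hP : P.IsUnimodular) : Nonempty (B.discriminantGroup ≃ₗ[ℤ] Q.discriminantGroup) := by
  obtain ⟨e⟩ := h
  obtain ⟨ι, -⟩ := exists_discriminantGroup_linearEquiv_prod_of_isUnimodular_left (Q := Q) hP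
  exact ⟨e.discriminantGroupCongr.trans ι.symm⟩

variable [Module.Finite ℤ N] [Module.Free ℤ N] [Module.Finite ℤ P₁] [Module.Free ℤ P₁] [Module.Finite ℤ P₂]
  [Module.Free ℤ P₂]

/-- **`Λ ≅ P ⊕ Q` with `P` even unimodular ⟹ `(A_Λ, b_Λ, q_Λ) ≅ (A_Q, b_Q, q_Q)`**: the isomorphism
`A_Λ ⥲ A_{P ⊕ Q} ⥲ A_Q` preserves the discriminant bilinear and quadratic forms (`q_{P ⊕ Q}(Ψ(0, a)) = q_P(0) + q_Q(a)`).
This is the mechanism of "`D(L_B) = D((h_d)^⊥_{L_{2t}})` (see (LB))". [cite: Nikulin1980, §1.3] [cite: Huybrechts2016K3, Ch. 14 §0.2] [cite: GritsenkoHulekSankaran2010Symplectic, §4 proof of Prop. 4.12] -/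
theorem exists_discriminantQuad_isometry_of_equivalent_prod_of_isUnimodular (h : B.Equivalent (P.prod Q))
    (hPu : P.IsUnimodular) (hPs : P.IsSymm) (hPe : P.IsEven) (hB : B.Nondegenerate) (hBs : B.IsSymm) (hBe : B.IsEven)
    (hQ : Q.Nondegenerate) (hQs : Q.IsSymm) (hQe : Q.IsEven) :
    ∃ φ : B.discriminantGroup ≃ₗ[ℤ] Q.discriminantGroup,
      (∀ a c, Q.discriminantBilin hQ hQs (φ a) (φ c) = B.discriminantBilin hB hBs a c) ∧
        ∀ a, Q.discriminantQuad hQ hQs hQe (φ a) = B.discriminantQuad hB hBs hBe a := by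
  obtain ⟨e⟩ := h
  obtain ⟨ι, hι⟩ := exists_discriminantGroup_linearEquiv_prod_of_isUnimodular_left (Q := Q) hPu
  refine ⟨e.discriminantGroupCongr.trans ι.symm, fun a c ↦ ?_, fun a ↦ ?_⟩
  · rw [← e.discriminantBilin_discriminantGroupCongr hB hBs (hPu.nondegenerate.prod hQ) (hPs.prod hQs) a c,
      LinearEquiv.trans_apply, LinearEquiv.trans_apply]
    conv_rhs => rw [← ι.apply_symm_apply (e.discriminantGroupCongr a), ← ι.apply_symm_apply (e.discriminantGroupCongr c),
      hι, hι]
    rw [discriminantBilin_discriminantGroupProdEquiv P Q hPu.nondegenerate hPs hQ hQs]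
    simp only [map_zero, zero_add]
  · rw [← e.discriminantQuad_discriminantGroupCongr hB hBs hBe (hPu.nondegenerate.prod hQ) (hPs.prod hQs)
      (isEven_prod_iff.2 ⟨hPe, hQe⟩) a, LinearEquiv.trans_apply]
    conv_rhs => rw [← ι.apply_symm_apply (e.discriminantGroupCongr a), hι]
    rw [discriminantQuad_discriminantGroupProdEquiv P Q hPu.nondegenerate hPs hPe hQ hQs hQe, discriminantQuad_zero,
      zero_add]

end Transport

/-! ### §2 A lattice `Λ ≅ P ⊕ L_B` with `P` even unimodular: `(A_Λ, b, q) ≅ (A_{L_B}, b, q)` and its consequences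

This is the shape in which the complement `(h_d)^⊥` is known (`P = 2U ⊕ 2E₈(−1)` for `L_{2t}`, `P = E₈(−1)^{⊕m} ⊕ U^{⊕(n+1)}`
for the models, §3; the lattices of record `Λ(K3^{[n]})`, `Λ(Kumⁿ)` have their own complement theorems of this shape). -/

section Abstract

variable {N : Type*} {P₁ : Type*} [AddCommGroup N] [AddCommGroup P₁] {Λ : BilinForm ℤ N} {P : BilinForm ℤ P₁} (t : ℕ)

/-- **`|A_Λ| = |D(L_B)| = (2d/f)(2t/f)`** for `Λ ≅ P ⊕ L_B`, `P` unimodular (`f²b = d + tc²`, `fa = 2tc`, `fD' = 2d`,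
`fT' = 2t`, `f, d ≠ 0`, `t ≥ 1`). [cite: GritsenkoHulekSankaran2010Symplectic, §4 Prop. 4.6 (iv) ("of determinant `4dt/f²`") and proof of Prop. 4.12] [cite: Nikulin1980, §1.3] -/
theorem natCard_discriminantGroup_of_equivalent_prod_generalDivisorGram (ht : 0 < t) {f b c a d D' T' : ℤ} (hf : f ≠ 0)
    (hd : d ≠ 0) (hb : f ^ 2 * b = d + t * c ^ 2) (ha : f * a = 2 * t * c) (hD : f * D' = 2 * d) (hT : f * T' = 2 * t)
    (h : Λ.Equivalent (P.prod (Matrix.toBilin' !![-(2 * b), a; a, -(2 * t : ℤ)]))) (hPu : P.IsUnimodular) :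
    Nat.card Λ.discriminantGroup = (D' * T').natAbs := by
  obtain ⟨φ⟩ := nonempty_discriminantGroup_linearEquiv_of_equivalent_prod_of_isUnimodular h hPu
  rw [Nat.card_congr φ.toEquiv, natCard_discriminantGroup_generalDivisorGram t ht hf hd hb ha hD hT]

/-- **`A_Λ ≅ ℤ/(2d/f) × ℤ/(2t/f)` as groups for `Λ ≅ P ⊕ L_B`, `P` unimodular, and `w = (f, 2t/f) = 1`** ("the
discriminant group […] is the orthogonal sum of two cyclic groups if `w = 1`"; `(f, c) = 1`, natural numbers `D', T'`
with `fD' = 2d`, `fT' = 2t`). [cite: GritsenkoHulekSankaran2010Symplectic, §4 proof of Prop. 4.12 and Remark 4.15] [cite: Nikulin1980, §1.3] -/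
theorem nonempty_discriminantGroup_addEquiv_zmod_prod_zmod_of_equivalent_prod_generalDivisorGram (ht : 0 < t)
    {f b c a d : ℤ} {D' T' : ℕ} (hf : f ≠ 0) (hd : d ≠ 0) (hb : f ^ 2 * b = d + t * c ^ 2) (ha : f * a = 2 * t * c)
    (hc : Int.gcd f c = 1) (hD : f * D' = 2 * d) (hT : f * T' = 2 * t) (hw : Int.gcd f T' = 1)
    (h : Λ.Equivalent (P.prod (Matrix.toBilin' !![-(2 * b), a; a, -(2 * t : ℤ)]))) (hPu : P.IsUnimodular) :
    Nonempty (Λ.discriminantGroup ≃+ ZMod D' × ZMod T') := by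
  obtain ⟨φ⟩ := nonempty_discriminantGroup_linearEquiv_of_equivalent_prod_of_isUnimodular h hPu
  obtain ⟨e, -, -⟩ := exists_discriminantGroup_addEquiv_zmod_prod_zmod t ht hf hd hb ha hc hD hT hw
  exact ⟨φ.toAddEquiv.trans e⟩

variable [Module.Finite ℤ N] [Module.Free ℤ N] [Module.Finite ℤ P₁] [Module.Free ℤ P₁]

/-- **`(A_Λ, b, q) ≅ (A_{L_B}, b, q)` for `Λ ≅ P ⊕ L_B` with `P` even unimodular** — "`D(L_B) = D((h_d)^⊥_{L_{2t}})`
(see (LB))" for `Λ = (h_d)^⊥ ≅ 2U ⊕ 2E₈(−1) ⊕ L_B` (`B = (−2b, a; a, −2t)`, `f²b = d + tc²`, `fa = 2tc`, `d ≠ 0`, `t ≥ 1`;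
`Λ` nondegenerate symmetric even, with arbitrary proof terms `hN hS hE`).
[cite: GritsenkoHulekSankaran2010Symplectic, §4 Prop. 4.6 (iv) and proof of Prop. 4.12] [cite: Nikulin1980, §1.3] -/
theorem exists_discriminantQuad_isometry_of_equivalent_prod_generalDivisorGram (ht : 0 < t) {f b c a d : ℤ} (hd : d ≠ 0)
    (hb : f ^ 2 * b = d + t * c ^ 2) (ha : f * a = 2 * t * c) (h : Λ.Equivalent (P.prod (Matrix.toBilin' !![-(2 * b), a; a, -(2 * t : ℤ)])))
    (hPu : P.IsUnimodular) (hPs : P.IsSymm) (hPe : P.IsEven) (hN : Λ.Nondegenerate) (hS : Λ.IsSymm) (hE : Λ.IsEven) :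
    ∃ φ : Λ.discriminantGroup ≃ₗ[ℤ] (Matrix.toBilin' !![-(2 * b), a; a, -(2 * t : ℤ)]).discriminantGroup,
      (∀ x y, (Matrix.toBilin' !![-(2 * b), a; a, -(2 * t : ℤ)]).discriminantBilin
          (nondegenerate_toBilin'_generalDivisorGram t ht hd hb ha) (isSymm_toBilin'_generalDivisorGram t b a) (φ x) (φ y) =
        Λ.discriminantBilin hN hS x y) ∧
      ∀ x, (Matrix.toBilin' !![-(2 * b), a; a, -(2 * t : ℤ)]).discriminantQuad
          (nondegenerate_toBilin'_generalDivisorGram t ht hd hb ha) (isSymm_toBilin'_generalDivisorGram t b a)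
          (isEven_toBilin'_generalDivisorGram t b a) (φ x) = Λ.discriminantQuad hN hS hE x :=
  exists_discriminantQuad_isometry_of_equivalent_prod_of_isUnimodular h hPu hPs hPe hN hS hE _ _ _

/-- **The printed elements `k̄₁, k̄₃` in `A_Λ = D(L_B)`** for `Λ ≅ P ⊕ L_B`, `P` even unimodular: there are `κ₁, κ₃ ∈ A_Λ`
(the images of `[ε₀]`, `[fε₁ − cε₀] ∈ D(L_B)`) with "the orders of `k̄₁` and of `k̄₃` in `D(L_B) = D((h_d)^⊥_{L_{2t}})`
[…] equal to `2d/f` and `2t/f` respectively" (`k·κ₁ = 0 ⟺ D' ∣ k`, `k·κ₃ = 0 ⟺ T' ∣ k`), "`k̄₁·k̄₃ = 0`",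
`q(κ₁) = −f²/2d`, "`k̄₃² ≡ −f²/2t mod 2`", and "`k̄₁` and `k̄₃` form a basis of `D(L_B)` if `w = 1`" (every class is
`kκ₁ + lκ₃` when `(f, 2t/f) = (f, T') = 1`). Here `f²b = d + tc²`, `fa = 2tc`, `(f, c) = 1`, `fD' = 2d`, `fT' = 2t`,
`f, d ≠ 0`, `t ≥ 1`. [cite: GritsenkoHulekSankaran2010Symplectic, §4 proof of Prop. 4.12] [cite: Nikulin1980, §1.3] -/
theorem exists_generators_discriminantGroup_of_equivalent_prod_generalDivisorGram (ht : 0 < t) {f b c a d D' T' : ℤ}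
    (hf : f ≠ 0) (hd : d ≠ 0) (hb : f ^ 2 * b = d + t * c ^ 2) (ha : f * a = 2 * t * c) (hc : Int.gcd f c = 1)
    (hD : f * D' = 2 * d) (hT : f * T' = 2 * t) (h : Λ.Equivalent (P.prod (Matrix.toBilin' !![-(2 * b), a; a, -(2 * t : ℤ)])))
    (hPu : P.IsUnimodular) (hPs : P.IsSymm) (hPe : P.IsEven) (hN : Λ.Nondegenerate) (hS : Λ.IsSymm) (hE : Λ.IsEven) :
    ∃ κ₁ κ₃ : Λ.discriminantGroup,
      (∀ k : ℤ, k • κ₁ = 0 ↔ D' ∣ k) ∧ (∀ k : ℤ, k • κ₃ = 0 ↔ T' ∣ k) ∧ Λ.discriminantBilin hN hS κ₁ κ₃ = 0 ∧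
      Λ.discriminantQuad hN hS hE κ₁ = ((-(f : ℚ) ^ 2 / (2 * d) : ℚ) : AddCircle (2 : ℚ)) ∧
      Λ.discriminantQuad hN hS hE κ₃ = ((-(f : ℚ) ^ 2 / (2 * t) : ℚ) : AddCircle (2 : ℚ)) ∧
      (Int.gcd f T' = 1 → ∀ x, ∃ k l : ℤ, x = k • κ₁ + l • κ₃) := by
  obtain ⟨φ, hφb, hφq⟩ := exists_discriminantQuad_isometry_of_equivalent_prod_generalDivisorGram t ht hd hb ha h hPu hPs
    hPe hN hS hE
  refine ⟨φ.symm (Submodule.Quotient.mk (LinearMap.proj 0 : Module.Dual ℤ (Fin 2 → ℤ))),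
    φ.symm (Submodule.Quotient.mk (f • (LinearMap.proj 1 : Module.Dual ℤ (Fin 2 → ℤ)) -
      c • (LinearMap.proj 0 : Module.Dual ℤ (Fin 2 → ℤ)))), fun k ↦ ?_, fun k ↦ ?_, ?_, ?_, ?_, fun hw x ↦ ?_⟩
  · rw [← zsmul_mk_proj_zero_eq_zero_iff t ht hf hb ha hc hD k, ← map_smul, φ.symm.map_eq_zero_iff]
  · rw [← zsmul_mk_sub_eq_zero_iff t hf hd hb ha hD hT k, ← map_smul, φ.symm.map_eq_zero_iff]
  · rw [← hφb, φ.apply_symm_apply, φ.apply_symm_apply]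
    exact discriminantBilin_mk_proj_zero_mk_sub_eq_zero t ht hf hd hb ha hD
  · rw [← hφq, φ.apply_symm_apply, discriminantQuad_mk, dualForm_proj_zero_proj_zero_eq t ht hf hd hb ha hD]
  · rw [← hφq, φ.apply_symm_apply]
    exact discriminantQuad_mk_sub_eq t ht hf hd hb ha hT
  · obtain ⟨ψ, hψ⟩ := (Matrix.toBilin' !![-(2 * b), a; a, -(2 * t : ℤ)]).discriminantGroup_mk_surjective (φ x)
    obtain ⟨k, l, hkl⟩ := exists_mk_eq_zsmul_add_zsmul t (b := b) hf ha hc hT hw ψ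
    refine ⟨k, l, ?_⟩
    rw [← map_smul, ← map_smul, ← map_add, ← hkl, hψ, φ.symm_apply_apply]

/-- **"It follows if `w = 1` the discriminant group is `D(h_d^⊥) = ⟨k̄₁⟩ ⊕ ⟨k̄₃⟩`"** for `Λ ≅ P ⊕ L_B`, `P` even unimodular,
`w = (f, 2t/f) = 1`: there are `κ₁, κ₃ ∈ A_Λ` and an isomorphism `A_Λ ≅ ℤ/(2d/f) × ℤ/(2t/f)` with `κ₁ ↦ (1, 0)`,
`κ₃ ↦ (0, 1)`, `b(κ₁, κ₃) = 0`, `q(κ₁) = −f²/2d`, `q(κ₃) = −f²/2t` ("the orthogonal sum of two cyclic groups if `w = 1`",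
Remark 4.15) — so `q(kκ₁ + lκ₃) = −k²f²/2d − l²f²/2t mod 2ℤ`. (`f²b = d + tc²`, `fa = 2tc`, `(f, c) = 1`, natural numbers
`D', T'` with `fD' = 2d`, `fT' = 2t`, `(f, T') = 1`, `f, d ≠ 0`, `t ≥ 1`.)
[cite: GritsenkoHulekSankaran2010Symplectic, §4 proof of Prop. 4.12 and Remark 4.15] [cite: Nikulin1980, §1.3] -/
theorem exists_discriminantGroup_addEquiv_zmod_prod_zmod_of_equivalent_prod_generalDivisorGram (ht : 0 < t)
    {f b c a d : ℤ} {D' T' : ℕ} (hf : f ≠ 0) (hd : d ≠ 0) (hb : f ^ 2 * b = d + t * c ^ 2) (ha : f * a = 2 * t * c)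
    (hc : Int.gcd f c = 1) (hD : f * D' = 2 * d) (hT : f * T' = 2 * t) (hw : Int.gcd f T' = 1)
    (h : Λ.Equivalent (P.prod (Matrix.toBilin' !![-(2 * b), a; a, -(2 * t : ℤ)]))) (hPu : P.IsUnimodular) (hPs : P.IsSymm)
    (hPe : P.IsEven) (hN : Λ.Nondegenerate) (hS : Λ.IsSymm) (hE : Λ.IsEven) :
    ∃ (κ₁ κ₃ : Λ.discriminantGroup) (e : Λ.discriminantGroup ≃+ ZMod D' × ZMod T'),
      e κ₁ = (1, 0) ∧ e κ₃ = (0, 1) ∧ Λ.discriminantBilin hN hS κ₁ κ₃ = 0 ∧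
      Λ.discriminantQuad hN hS hE κ₁ = ((-(f : ℚ) ^ 2 / (2 * d) : ℚ) : AddCircle (2 : ℚ)) ∧
      Λ.discriminantQuad hN hS hE κ₃ = ((-(f : ℚ) ^ 2 / (2 * t) : ℚ) : AddCircle (2 : ℚ)) := by
  obtain ⟨φ, hφb, hφq⟩ := exists_discriminantQuad_isometry_of_equivalent_prod_generalDivisorGram t ht hd hb ha h hPu hPs
    hPe hN hS hE
  obtain ⟨e, he₁, he₃⟩ := exists_discriminantGroup_addEquiv_zmod_prod_zmod t ht hf hd hb ha hc hD hT hw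
  refine ⟨φ.symm (Submodule.Quotient.mk (LinearMap.proj 0 : Module.Dual ℤ (Fin 2 → ℤ))),
    φ.symm (Submodule.Quotient.mk (f • (LinearMap.proj 1 : Module.Dual ℤ (Fin 2 → ℤ)) -
      c • (LinearMap.proj 0 : Module.Dual ℤ (Fin 2 → ℤ)))), φ.toAddEquiv.trans e, ?_, ?_, ?_, ?_, ?_⟩
  · change e (φ (φ.symm _)) = _
    rw [φ.apply_symm_apply, he₁]
  · change e (φ (φ.symm _)) = _
    rw [φ.apply_symm_apply, he₃]
  · rw [← hφb, φ.apply_symm_apply, φ.apply_symm_apply]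
    exact discriminantBilin_mk_proj_zero_mk_sub_eq_zero t ht hf hd hb ha (D' := D') (by exact_mod_cast hD)
  · rw [← hφq, φ.apply_symm_apply, discriminantQuad_mk,
      dualForm_proj_zero_proj_zero_eq t ht hf hd hb ha (D' := D') (by exact_mod_cast hD)]
  · rw [← hφq, φ.apply_symm_apply]
    exact discriminantQuad_mk_sub_eq t ht hf hd hb ha (T' := T') (by exact_mod_cast hT)

end Abstract

/-! ### §3 The models `(E₈(−1)^{⊕m} ⊕ U^{⊕(n+2)}) ⊕ ℤ(−2t)` (`L_{2t}`: `m = 2`, `n = 1`): `D((h_d)^⊥)` for every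
primitive `h_d` with `(h_d, L) = fℤ` -/

section Model

variable (m n t : ℕ)

/-- The form restricted to `h^⊥` is symmetric. [cite: GritsenkoHulekSankaran2010Symplectic, §4 Prop. 4.6 (iv)] -/
theorem isSymm_restrict_orthogonal_model (k : ℕ) (r : ((Fin m → Fin 8 → ℤ) × ((Fin k → ℤ) × (Fin k → ℤ))) × ℤ) :
    ((((LinearMap.BilinForm.pi fun _ : Fin m ↦ -e8Form).prod (hyperbolicSum k)).prod
        ((-(2 * t : ℤ)) • LinearMap.mul ℤ ℤ)).restrict
      ((((LinearMap.BilinForm.pi fun _ : Fin m ↦ -e8Form).prod (hyperbolicSum k)).prod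
        ((-(2 * t : ℤ)) • LinearMap.mul ℤ ℤ)).orthogonal (ℤ ∙ r))).IsSymm := by
  obtain ⟨hs, he, -⟩ := isSymm_isEven_isUnimodular_pi_neg_e8Form_prod_hyperbolicSum' m k
  exact ⟨fun x y ↦ (isSymm_isEven_prod_neg_twoMul_smul_mul _ t hs he).1.eq x y⟩

/-- The form restricted to `h^⊥` is even. [cite: GritsenkoHulekSankaran2010Symplectic, §4 Prop. 4.6 (iv)] -/
theorem isEven_restrict_orthogonal_model (k : ℕ) (r : ((Fin m → Fin 8 → ℤ) × ((Fin k → ℤ) × (Fin k → ℤ))) × ℤ) :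
    ((((LinearMap.BilinForm.pi fun _ : Fin m ↦ -e8Form).prod (hyperbolicSum k)).prod
        ((-(2 * t : ℤ)) • LinearMap.mul ℤ ℤ)).restrict
      ((((LinearMap.BilinForm.pi fun _ : Fin m ↦ -e8Form).prod (hyperbolicSum k)).prod
        ((-(2 * t : ℤ)) • LinearMap.mul ℤ ℤ)).orthogonal (ℤ ∙ r))).IsEven := by
  obtain ⟨hs, he, -⟩ := isSymm_isEven_isUnimodular_pi_neg_e8Form_prod_hyperbolicSum' m k
  exact isEven_restrict (isSymm_isEven_prod_neg_twoMul_smul_mul _ t hs he).2 _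

/-- The form restricted to `h^⊥` is nondegenerate for `h² = 2d ≠ 0`, `(h, L) = fℤ` (`t ≥ 1`): it is isometric to
`(E₈(−1)^{⊕m} ⊕ U^{⊕(n+1)}) ⊕ B` with `det B = 4dt/f² ≠ 0`. [cite: GritsenkoHulekSankaran2010Symplectic, §4 Prop. 4.6 (iv)] -/
theorem nondegenerate_restrict_orthogonal_model_of_divisor (ht : 0 < t) {f d b a : ℤ} (hf : f ≠ 0) (hd : d ≠ 0)
    {r : ((Fin m → Fin 8 → ℤ) × ((Fin (n + 2) → ℤ) × (Fin (n + 2) → ℤ))) × ℤ}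
    (hr : (((LinearMap.BilinForm.pi fun _ : Fin m ↦ -e8Form).prod (hyperbolicSum (n + 2))).prod
      ((-(2 * t : ℤ)) • LinearMap.mul ℤ ℤ)) r r = 2 * d)
    (hfr : ∀ z, f ∣ (((LinearMap.BilinForm.pi fun _ : Fin m ↦ -e8Form).prod (hyperbolicSum (n + 2))).prod
      ((-(2 * t : ℤ)) • LinearMap.mul ℤ ℤ)) r z)
    (hr' : ∃ r', (((LinearMap.BilinForm.pi fun _ : Fin m ↦ -e8Form).prod (hyperbolicSum (n + 2))).prod
      ((-(2 * t : ℤ)) • LinearMap.mul ℤ ℤ)) r r' = f)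
    (hb : f ^ 2 * b = d + t * r.2 ^ 2) (ha : f * a = 2 * t * r.2) :
    ((((LinearMap.BilinForm.pi fun _ : Fin m ↦ -e8Form).prod (hyperbolicSum (n + 2))).prod
        ((-(2 * t : ℤ)) • LinearMap.mul ℤ ℤ)).restrict
      ((((LinearMap.BilinForm.pi fun _ : Fin m ↦ -e8Form).prod (hyperbolicSum (n + 2))).prod
        ((-(2 * t : ℤ)) • LinearMap.mul ℤ ℤ)).orthogonal (ℤ ∙ r))).Nondegenerate := by
  obtain ⟨-, -, hu⟩ := isSymm_isEven_isUnimodular_pi_neg_e8Form_prod_hyperbolicSum' m (n + 1)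
  obtain ⟨e⟩ := restrict_orthogonal_model_equivalent_of_divisor m n t ht hf hr hfr hr' hb ha
  exact e.symm.nondegenerate (hu.nondegenerate.prod (nondegenerate_toBilin'_generalDivisorGram t ht hd hb ha))

/-- **"`D(L_B) = D((h_d)^⊥_{L_{2t}})` (see (LB))" as an isomorphism of finite quadratic forms**: for every primitive `h`
of `(E₈(−1)^{⊕m} ⊕ U^{⊕(n+2)}) ⊕ ℤ(−2t)` with `h² = 2d ≠ 0`, `(h, L) = fℤ` (`t ≥ 1`, `f ≠ 0`; `c = h.2`, `f²b = d + tc²`,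
`fa = 2tc`) there is `φ : A_{h^⊥} ⥲ A_{L_B}`, `B = (−2b, a; a, −2t)`, with `b_{L_B}(φx, φy) = b_{h^⊥}(x, y)` and
`q_{L_B}(φx) = q_{h^⊥}(x)` (`h^⊥ ≅ (E₈(−1)^{⊕m} ⊕ U^{⊕(n+1)}) ⊕ L_B` and §2).
[cite: GritsenkoHulekSankaran2010Symplectic, §4 Prop. 4.6 (iv) and proof of Prop. 4.12] [cite: Nikulin1980, §1.3] -/
theorem exists_discriminantQuad_isometry_restrict_orthogonal_model_of_divisor (ht : 0 < t) {f d b a : ℤ} (hf : f ≠ 0)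
    (hd : d ≠ 0)
    {r : ((Fin m → Fin 8 → ℤ) × ((Fin (n + 2) → ℤ) × (Fin (n + 2) → ℤ))) × ℤ}
    (hr : (((LinearMap.BilinForm.pi fun _ : Fin m ↦ -e8Form).prod (hyperbolicSum (n + 2))).prod
      ((-(2 * t : ℤ)) • LinearMap.mul ℤ ℤ)) r r = 2 * d)
    (hfr : ∀ z, f ∣ (((LinearMap.BilinForm.pi fun _ : Fin m ↦ -e8Form).prod (hyperbolicSum (n + 2))).prod
      ((-(2 * t : ℤ)) • LinearMap.mul ℤ ℤ)) r z)
    (hr' : ∃ r', (((LinearMap.BilinForm.pi fun _ : Fin m ↦ -e8Form).prod (hyperbolicSum (n + 2))).prod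
      ((-(2 * t : ℤ)) • LinearMap.mul ℤ ℤ)) r r' = f)
    (hb : f ^ 2 * b = d + t * r.2 ^ 2) (ha : f * a = 2 * t * r.2)
    (hN : ((((LinearMap.BilinForm.pi fun _ : Fin m ↦ -e8Form).prod (hyperbolicSum (n + 2))).prod
        ((-(2 * t : ℤ)) • LinearMap.mul ℤ ℤ)).restrict
      ((((LinearMap.BilinForm.pi fun _ : Fin m ↦ -e8Form).prod (hyperbolicSum (n + 2))).prod
        ((-(2 * t : ℤ)) • LinearMap.mul ℤ ℤ)).orthogonal (ℤ ∙ r))).Nondegenerate)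
    (hS : ((((LinearMap.BilinForm.pi fun _ : Fin m ↦ -e8Form).prod (hyperbolicSum (n + 2))).prod
        ((-(2 * t : ℤ)) • LinearMap.mul ℤ ℤ)).restrict
      ((((LinearMap.BilinForm.pi fun _ : Fin m ↦ -e8Form).prod (hyperbolicSum (n + 2))).prod
        ((-(2 * t : ℤ)) • LinearMap.mul ℤ ℤ)).orthogonal (ℤ ∙ r))).IsSymm)
    (hE : ((((LinearMap.BilinForm.pi fun _ : Fin m ↦ -e8Form).prod (hyperbolicSum (n + 2))).prod
        ((-(2 * t : ℤ)) • LinearMap.mul ℤ ℤ)).restrict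
      ((((LinearMap.BilinForm.pi fun _ : Fin m ↦ -e8Form).prod (hyperbolicSum (n + 2))).prod
        ((-(2 * t : ℤ)) • LinearMap.mul ℤ ℤ)).orthogonal (ℤ ∙ r))).IsEven) :
    ∃ φ : ((((LinearMap.BilinForm.pi fun _ : Fin m ↦ -e8Form).prod (hyperbolicSum (n + 2))).prod
        ((-(2 * t : ℤ)) • LinearMap.mul ℤ ℤ)).restrict
      ((((LinearMap.BilinForm.pi fun _ : Fin m ↦ -e8Form).prod (hyperbolicSum (n + 2))).prod
        ((-(2 * t : ℤ)) • LinearMap.mul ℤ ℤ)).orthogonal (ℤ ∙ r))).discriminantGroup ≃ₗ[ℤ]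
        (Matrix.toBilin' !![-(2 * b), a; a, -(2 * t : ℤ)]).discriminantGroup,
      (∀ x y, (Matrix.toBilin' !![-(2 * b), a; a, -(2 * t : ℤ)]).discriminantBilin
          (nondegenerate_toBilin'_generalDivisorGram t ht hd hb ha) (isSymm_toBilin'_generalDivisorGram t b a) (φ x) (φ y) =
        ((((LinearMap.BilinForm.pi fun _ : Fin m ↦ -e8Form).prod (hyperbolicSum (n + 2))).prod
        ((-(2 * t : ℤ)) • LinearMap.mul ℤ ℤ)).restrict
      ((((LinearMap.BilinForm.pi fun _ : Fin m ↦ -e8Form).prod (hyperbolicSum (n + 2))).prod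
        ((-(2 * t : ℤ)) • LinearMap.mul ℤ ℤ)).orthogonal (ℤ ∙ r))).discriminantBilin hN hS x y) ∧
      ∀ x, (Matrix.toBilin' !![-(2 * b), a; a, -(2 * t : ℤ)]).discriminantQuad
          (nondegenerate_toBilin'_generalDivisorGram t ht hd hb ha) (isSymm_toBilin'_generalDivisorGram t b a)
          (isEven_toBilin'_generalDivisorGram t b a) (φ x) =
        ((((LinearMap.BilinForm.pi fun _ : Fin m ↦ -e8Form).prod (hyperbolicSum (n + 2))).prod
        ((-(2 * t : ℤ)) • LinearMap.mul ℤ ℤ)).restrict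
      ((((LinearMap.BilinForm.pi fun _ : Fin m ↦ -e8Form).prod (hyperbolicSum (n + 2))).prod
        ((-(2 * t : ℤ)) • LinearMap.mul ℤ ℤ)).orthogonal (ℤ ∙ r))).discriminantQuad hN hS hE x := by
  obtain ⟨hs, he, hu⟩ := isSymm_isEven_isUnimodular_pi_neg_e8Form_prod_hyperbolicSum' m (n + 1)
  exact exists_discriminantQuad_isometry_of_equivalent_prod_generalDivisorGram t ht hd hb ha
    (restrict_orthogonal_model_equivalent_of_divisor m n t ht hf hr hfr hr' hb ha) hu hs he hN hS hE

/-- **`D(h^⊥) ≅ D(L_B)` as groups** (no `d ≠ 0` needed). [cite: GritsenkoHulekSankaran2010Symplectic, §4 proof of Prop. 4.12 ("`D(L_B) = D((h_d)^⊥_{L_{2t}})`")] [cite: Nikulin1980, §1.3] -/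
theorem nonempty_discriminantGroup_restrict_orthogonal_model_linearEquiv_of_divisor (ht : 0 < t) {f d b a : ℤ}
    (hf : f ≠ 0)
    {r : ((Fin m → Fin 8 → ℤ) × ((Fin (n + 2) → ℤ) × (Fin (n + 2) → ℤ))) × ℤ}
    (hr : (((LinearMap.BilinForm.pi fun _ : Fin m ↦ -e8Form).prod (hyperbolicSum (n + 2))).prod
      ((-(2 * t : ℤ)) • LinearMap.mul ℤ ℤ)) r r = 2 * d)
    (hfr : ∀ z, f ∣ (((LinearMap.BilinForm.pi fun _ : Fin m ↦ -e8Form).prod (hyperbolicSum (n + 2))).prod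
      ((-(2 * t : ℤ)) • LinearMap.mul ℤ ℤ)) r z)
    (hr' : ∃ r', (((LinearMap.BilinForm.pi fun _ : Fin m ↦ -e8Form).prod (hyperbolicSum (n + 2))).prod
      ((-(2 * t : ℤ)) • LinearMap.mul ℤ ℤ)) r r' = f)
    (hb : f ^ 2 * b = d + t * r.2 ^ 2) (ha : f * a = 2 * t * r.2) :
    Nonempty (((((LinearMap.BilinForm.pi fun _ : Fin m ↦ -e8Form).prod (hyperbolicSum (n + 2))).prod
        ((-(2 * t : ℤ)) • LinearMap.mul ℤ ℤ)).restrict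
      ((((LinearMap.BilinForm.pi fun _ : Fin m ↦ -e8Form).prod (hyperbolicSum (n + 2))).prod
        ((-(2 * t : ℤ)) • LinearMap.mul ℤ ℤ)).orthogonal (ℤ ∙ r))).discriminantGroup ≃ₗ[ℤ]
        (Matrix.toBilin' !![-(2 * b), a; a, -(2 * t : ℤ)]).discriminantGroup) := by
  obtain ⟨-, -, hu⟩ := isSymm_isEven_isUnimodular_pi_neg_e8Form_prod_hyperbolicSum' m (n + 1)
  exact nonempty_discriminantGroup_linearEquiv_of_equivalent_prod_of_isUnimodular
    (restrict_orthogonal_model_equivalent_of_divisor m n t ht hf hr hfr hr' hb ha) hu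

/-- **`|D((h_d)^⊥)| = (2d/f)·(2t/f) = 4dt/f²`** (`fD' = 2d`, `fT' = 2t`; "of determinant `4dt/f²`"; the tree's
`natCard_discriminantGroup_restrict_orthogonal_model_mul_sq` is the form `|D(h^⊥)|·f² = |2d|·2t`).
[cite: GritsenkoHulekSankaran2010Symplectic, §4 Prop. 4.6 (iv) and proof of Prop. 4.12] -/
theorem natCard_discriminantGroup_restrict_orthogonal_model_of_divisor (ht : 0 < t) {f d b a D' T' : ℤ} (hf : f ≠ 0)
    (hd : d ≠ 0)
    {r : ((Fin m → Fin 8 → ℤ) × ((Fin (n + 2) → ℤ) × (Fin (n + 2) → ℤ))) × ℤ}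
    (hr : (((LinearMap.BilinForm.pi fun _ : Fin m ↦ -e8Form).prod (hyperbolicSum (n + 2))).prod
      ((-(2 * t : ℤ)) • LinearMap.mul ℤ ℤ)) r r = 2 * d)
    (hfr : ∀ z, f ∣ (((LinearMap.BilinForm.pi fun _ : Fin m ↦ -e8Form).prod (hyperbolicSum (n + 2))).prod
      ((-(2 * t : ℤ)) • LinearMap.mul ℤ ℤ)) r z)
    (hr' : ∃ r', (((LinearMap.BilinForm.pi fun _ : Fin m ↦ -e8Form).prod (hyperbolicSum (n + 2))).prod
      ((-(2 * t : ℤ)) • LinearMap.mul ℤ ℤ)) r r' = f)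
    (hb : f ^ 2 * b = d + t * r.2 ^ 2) (ha : f * a = 2 * t * r.2) (hD : f * D' = 2 * d) (hT : f * T' = 2 * t) :
    Nat.card ((((LinearMap.BilinForm.pi fun _ : Fin m ↦ -e8Form).prod (hyperbolicSum (n + 2))).prod
        ((-(2 * t : ℤ)) • LinearMap.mul ℤ ℤ)).restrict
      ((((LinearMap.BilinForm.pi fun _ : Fin m ↦ -e8Form).prod (hyperbolicSum (n + 2))).prod
        ((-(2 * t : ℤ)) • LinearMap.mul ℤ ℤ)).orthogonal (ℤ ∙ r))).discriminantGroup = (D' * T').natAbs := by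
  obtain ⟨-, -, hu⟩ := isSymm_isEven_isUnimodular_pi_neg_e8Form_prod_hyperbolicSum' m (n + 1)
  exact natCard_discriminantGroup_of_equivalent_prod_generalDivisorGram t ht hf hd hb ha hD hT
    (restrict_orthogonal_model_equivalent_of_divisor m n t ht hf hr hfr hr' hb ha) hu

/-- **The printed elements `k̄₁, k̄₃ ∈ D((h_d)^⊥)`** in the models: there are `κ₁, κ₃ ∈ D(h^⊥)` with "the orders of `k̄₁`
and of `k̄₃` in `D(L_B) = D((h_d)^⊥_{L_{2t}})` […] equal to `2d/f` and `2t/f` respectively" (`k·κ₁ = 0 ⟺ D' ∣ k`,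
`k·κ₃ = 0 ⟺ T' ∣ k`), "`k̄₁·k̄₃ = 0`", `q(κ₁) = −f²/2d`, "`k̄₃² ≡ −f²/2t mod 2`", and "`k̄₁` and `k̄₃` form a basis of
`D(L_B)` if `w = 1`" (every class is `kκ₁ + lκ₃` when `(f, 2t/f) = 1`). Hypotheses: `h` in the model with `h² = 2d ≠ 0`,
`(h, L) = fℤ`, `c = h.2` with `(f, c) = 1`, `f²b = d + tc²`, `fa = 2tc`, `fD' = 2d`, `fT' = 2t`, `t ≥ 1`.
[cite: GritsenkoHulekSankaran2010Symplectic, §4 proof of Prop. 4.12] -/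
theorem exists_generators_discriminantGroup_restrict_orthogonal_model_of_divisor (ht : 0 < t) {f d b a D' T' : ℤ}
    (hf : f ≠ 0) (hd : d ≠ 0)
    {r : ((Fin m → Fin 8 → ℤ) × ((Fin (n + 2) → ℤ) × (Fin (n + 2) → ℤ))) × ℤ}
    (hr : (((LinearMap.BilinForm.pi fun _ : Fin m ↦ -e8Form).prod (hyperbolicSum (n + 2))).prod
      ((-(2 * t : ℤ)) • LinearMap.mul ℤ ℤ)) r r = 2 * d)
    (hfr : ∀ z, f ∣ (((LinearMap.BilinForm.pi fun _ : Fin m ↦ -e8Form).prod (hyperbolicSum (n + 2))).prod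
      ((-(2 * t : ℤ)) • LinearMap.mul ℤ ℤ)) r z)
    (hr' : ∃ r', (((LinearMap.BilinForm.pi fun _ : Fin m ↦ -e8Form).prod (hyperbolicSum (n + 2))).prod
      ((-(2 * t : ℤ)) • LinearMap.mul ℤ ℤ)) r r' = f)
    (hb : f ^ 2 * b = d + t * r.2 ^ 2) (ha : f * a = 2 * t * r.2) (hc : Int.gcd f r.2 = 1)
    (hD : f * D' = 2 * d) (hT : f * T' = 2 * t)
    (hN : ((((LinearMap.BilinForm.pi fun _ : Fin m ↦ -e8Form).prod (hyperbolicSum (n + 2))).prod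
        ((-(2 * t : ℤ)) • LinearMap.mul ℤ ℤ)).restrict
      ((((LinearMap.BilinForm.pi fun _ : Fin m ↦ -e8Form).prod (hyperbolicSum (n + 2))).prod
        ((-(2 * t : ℤ)) • LinearMap.mul ℤ ℤ)).orthogonal (ℤ ∙ r))).Nondegenerate)
    (hS : ((((LinearMap.BilinForm.pi fun _ : Fin m ↦ -e8Form).prod (hyperbolicSum (n + 2))).prod
        ((-(2 * t : ℤ)) • LinearMap.mul ℤ ℤ)).restrict
      ((((LinearMap.BilinForm.pi fun _ : Fin m ↦ -e8Form).prod (hyperbolicSum (n + 2))).prod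
        ((-(2 * t : ℤ)) • LinearMap.mul ℤ ℤ)).orthogonal (ℤ ∙ r))).IsSymm)
    (hE : ((((LinearMap.BilinForm.pi fun _ : Fin m ↦ -e8Form).prod (hyperbolicSum (n + 2))).prod
        ((-(2 * t : ℤ)) • LinearMap.mul ℤ ℤ)).restrict
      ((((LinearMap.BilinForm.pi fun _ : Fin m ↦ -e8Form).prod (hyperbolicSum (n + 2))).prod
        ((-(2 * t : ℤ)) • LinearMap.mul ℤ ℤ)).orthogonal (ℤ ∙ r))).IsEven) :
    ∃ κ₁ κ₃ : ((((LinearMap.BilinForm.pi fun _ : Fin m ↦ -e8Form).prod (hyperbolicSum (n + 2))).prod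
        ((-(2 * t : ℤ)) • LinearMap.mul ℤ ℤ)).restrict
      ((((LinearMap.BilinForm.pi fun _ : Fin m ↦ -e8Form).prod (hyperbolicSum (n + 2))).prod
        ((-(2 * t : ℤ)) • LinearMap.mul ℤ ℤ)).orthogonal (ℤ ∙ r))).discriminantGroup,
      (∀ k : ℤ, k • κ₁ = 0 ↔ D' ∣ k) ∧ (∀ k : ℤ, k • κ₃ = 0 ↔ T' ∣ k) ∧
      ((((LinearMap.BilinForm.pi fun _ : Fin m ↦ -e8Form).prod (hyperbolicSum (n + 2))).prod
        ((-(2 * t : ℤ)) • LinearMap.mul ℤ ℤ)).restrict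
      ((((LinearMap.BilinForm.pi fun _ : Fin m ↦ -e8Form).prod (hyperbolicSum (n + 2))).prod
        ((-(2 * t : ℤ)) • LinearMap.mul ℤ ℤ)).orthogonal (ℤ ∙ r))).discriminantBilin hN hS κ₁ κ₃ = 0 ∧
      ((((LinearMap.BilinForm.pi fun _ : Fin m ↦ -e8Form).prod (hyperbolicSum (n + 2))).prod
        ((-(2 * t : ℤ)) • LinearMap.mul ℤ ℤ)).restrict
      ((((LinearMap.BilinForm.pi fun _ : Fin m ↦ -e8Form).prod (hyperbolicSum (n + 2))).prod
        ((-(2 * t : ℤ)) • LinearMap.mul ℤ ℤ)).orthogonal (ℤ ∙ r))).discriminantQuad hN hS hE κ₁ =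
        ((-(f : ℚ) ^ 2 / (2 * d) : ℚ) : AddCircle (2 : ℚ)) ∧
      ((((LinearMap.BilinForm.pi fun _ : Fin m ↦ -e8Form).prod (hyperbolicSum (n + 2))).prod
        ((-(2 * t : ℤ)) • LinearMap.mul ℤ ℤ)).restrict
      ((((LinearMap.BilinForm.pi fun _ : Fin m ↦ -e8Form).prod (hyperbolicSum (n + 2))).prod
        ((-(2 * t : ℤ)) • LinearMap.mul ℤ ℤ)).orthogonal (ℤ ∙ r))).discriminantQuad hN hS hE κ₃ =
        ((-(f : ℚ) ^ 2 / (2 * t) : ℚ) : AddCircle (2 : ℚ)) ∧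
      (Int.gcd f T' = 1 → ∀ x, ∃ k l : ℤ, x = k • κ₁ + l • κ₃) := by
  obtain ⟨hs, he, hu⟩ := isSymm_isEven_isUnimodular_pi_neg_e8Form_prod_hyperbolicSum' m (n + 1)
  exact exists_generators_discriminantGroup_of_equivalent_prod_generalDivisorGram t ht hf hd hb ha hc hD hT
    (restrict_orthogonal_model_equivalent_of_divisor m n t ht hf hr hfr hr' hb ha) hu hs he hN hS hE

/-- **"It follows if `w = 1` the discriminant group is `D(h_d^⊥) = ⟨k̄₁⟩ ⊕ ⟨k̄₃⟩`"** in the models: for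
`w = (f, 2t/f) = 1` there are `κ₁, κ₃ ∈ D(h^⊥)` and an isomorphism `D(h^⊥) ≅ ℤ/(2d/f) × ℤ/(2t/f)` with `κ₁ ↦ (1, 0)`,
`κ₃ ↦ (0, 1)`, where `b(κ₁, κ₃) = 0`, `q(κ₁) = −f²/2d` and `q(κ₃) = −f²/2t` ("the orthogonal sum of two cyclic groups if
`w = 1`", Remark 4.15) — so the discriminant form of `(h_d)^⊥` is `q(kκ₁ + lκ₃) = −k²f²/2d − l²f²/2t mod 2ℤ`. Hypotheses:
`h` in the model with `h² = 2d ≠ 0`, `(h, L) = fℤ`, `c = h.2` with `(f, c) = 1`, `f²b = d + tc²`, `fa = 2tc`, natural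
numbers `D', T'` with `fD' = 2d`, `fT' = 2t`, `(f, T') = 1`, `t ≥ 1`.
[cite: GritsenkoHulekSankaran2010Symplectic, §4 proof of Prop. 4.12 and Remark 4.15] -/
theorem exists_discriminantGroup_restrict_orthogonal_model_addEquiv_zmod_prod_zmod (ht : 0 < t) {f d b a : ℤ}
    {D' T' : ℕ} (hf : f ≠ 0) (hd : d ≠ 0)
    {r : ((Fin m → Fin 8 → ℤ) × ((Fin (n + 2) → ℤ) × (Fin (n + 2) → ℤ))) × ℤ}
    (hr : (((LinearMap.BilinForm.pi fun _ : Fin m ↦ -e8Form).prod (hyperbolicSum (n + 2))).prod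
      ((-(2 * t : ℤ)) • LinearMap.mul ℤ ℤ)) r r = 2 * d)
    (hfr : ∀ z, f ∣ (((LinearMap.BilinForm.pi fun _ : Fin m ↦ -e8Form).prod (hyperbolicSum (n + 2))).prod
      ((-(2 * t : ℤ)) • LinearMap.mul ℤ ℤ)) r z)
    (hr' : ∃ r', (((LinearMap.BilinForm.pi fun _ : Fin m ↦ -e8Form).prod (hyperbolicSum (n + 2))).prod
      ((-(2 * t : ℤ)) • LinearMap.mul ℤ ℤ)) r r' = f)
    (hb : f ^ 2 * b = d + t * r.2 ^ 2) (ha : f * a = 2 * t * r.2) (hc : Int.gcd f r.2 = 1)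
    (hD : f * D' = 2 * d) (hT : f * T' = 2 * t) (hw : Int.gcd f T' = 1)
    (hN : ((((LinearMap.BilinForm.pi fun _ : Fin m ↦ -e8Form).prod (hyperbolicSum (n + 2))).prod
        ((-(2 * t : ℤ)) • LinearMap.mul ℤ ℤ)).restrict
      ((((LinearMap.BilinForm.pi fun _ : Fin m ↦ -e8Form).prod (hyperbolicSum (n + 2))).prod
        ((-(2 * t : ℤ)) • LinearMap.mul ℤ ℤ)).orthogonal (ℤ ∙ r))).Nondegenerate)
    (hS : ((((LinearMap.BilinForm.pi fun _ : Fin m ↦ -e8Form).prod (hyperbolicSum (n + 2))).prod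
        ((-(2 * t : ℤ)) • LinearMap.mul ℤ ℤ)).restrict
      ((((LinearMap.BilinForm.pi fun _ : Fin m ↦ -e8Form).prod (hyperbolicSum (n + 2))).prod
        ((-(2 * t : ℤ)) • LinearMap.mul ℤ ℤ)).orthogonal (ℤ ∙ r))).IsSymm)
    (hE : ((((LinearMap.BilinForm.pi fun _ : Fin m ↦ -e8Form).prod (hyperbolicSum (n + 2))).prod
        ((-(2 * t : ℤ)) • LinearMap.mul ℤ ℤ)).restrict
      ((((LinearMap.BilinForm.pi fun _ : Fin m ↦ -e8Form).prod (hyperbolicSum (n + 2))).prod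
        ((-(2 * t : ℤ)) • LinearMap.mul ℤ ℤ)).orthogonal (ℤ ∙ r))).IsEven) :
    ∃ (κ₁ κ₃ : ((((LinearMap.BilinForm.pi fun _ : Fin m ↦ -e8Form).prod (hyperbolicSum (n + 2))).prod
        ((-(2 * t : ℤ)) • LinearMap.mul ℤ ℤ)).restrict
      ((((LinearMap.BilinForm.pi fun _ : Fin m ↦ -e8Form).prod (hyperbolicSum (n + 2))).prod
        ((-(2 * t : ℤ)) • LinearMap.mul ℤ ℤ)).orthogonal (ℤ ∙ r))).discriminantGroup)
      (e : ((((LinearMap.BilinForm.pi fun _ : Fin m ↦ -e8Form).prod (hyperbolicSum (n + 2))).prod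
        ((-(2 * t : ℤ)) • LinearMap.mul ℤ ℤ)).restrict
      ((((LinearMap.BilinForm.pi fun _ : Fin m ↦ -e8Form).prod (hyperbolicSum (n + 2))).prod
        ((-(2 * t : ℤ)) • LinearMap.mul ℤ ℤ)).orthogonal (ℤ ∙ r))).discriminantGroup ≃+ ZMod D' × ZMod T'),
      e κ₁ = (1, 0) ∧ e κ₃ = (0, 1) ∧
      ((((LinearMap.BilinForm.pi fun _ : Fin m ↦ -e8Form).prod (hyperbolicSum (n + 2))).prod
        ((-(2 * t : ℤ)) • LinearMap.mul ℤ ℤ)).restrict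
      ((((LinearMap.BilinForm.pi fun _ : Fin m ↦ -e8Form).prod (hyperbolicSum (n + 2))).prod
        ((-(2 * t : ℤ)) • LinearMap.mul ℤ ℤ)).orthogonal (ℤ ∙ r))).discriminantBilin hN hS κ₁ κ₃ = 0 ∧
      ((((LinearMap.BilinForm.pi fun _ : Fin m ↦ -e8Form).prod (hyperbolicSum (n + 2))).prod
        ((-(2 * t : ℤ)) • LinearMap.mul ℤ ℤ)).restrict
      ((((LinearMap.BilinForm.pi fun _ : Fin m ↦ -e8Form).prod (hyperbolicSum (n + 2))).prod
        ((-(2 * t : ℤ)) • LinearMap.mul ℤ ℤ)).orthogonal (ℤ ∙ r))).discriminantQuad hN hS hE κ₁ =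
        ((-(f : ℚ) ^ 2 / (2 * d) : ℚ) : AddCircle (2 : ℚ)) ∧
      ((((LinearMap.BilinForm.pi fun _ : Fin m ↦ -e8Form).prod (hyperbolicSum (n + 2))).prod
        ((-(2 * t : ℤ)) • LinearMap.mul ℤ ℤ)).restrict
      ((((LinearMap.BilinForm.pi fun _ : Fin m ↦ -e8Form).prod (hyperbolicSum (n + 2))).prod
        ((-(2 * t : ℤ)) • LinearMap.mul ℤ ℤ)).orthogonal (ℤ ∙ r))).discriminantQuad hN hS hE κ₃ =
        ((-(f : ℚ) ^ 2 / (2 * t) : ℚ) : AddCircle (2 : ℚ)) := by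
  obtain ⟨hs, he, hu⟩ := isSymm_isEven_isUnimodular_pi_neg_e8Form_prod_hyperbolicSum' m (n + 1)
  exact exists_discriminantGroup_addEquiv_zmod_prod_zmod_of_equivalent_prod_generalDivisorGram t ht hf hd hb ha hc hD hT hw
    (restrict_orthogonal_model_equivalent_of_divisor m n t ht hf hr hfr hr' hb ha) hu hs he hN hS hE

/-- **`D((h_d)^⊥) ≅ ℤ/(2d/f) × ℤ/(2t/f)` for `w = 1`** in the models, the bare group statement ("the discriminant group
[…] is the orthogonal sum of two cyclic groups if `w = 1`"). [cite: GritsenkoHulekSankaran2010Symplectic, §4 proof of Prop. 4.12 and Remark 4.15] -/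
theorem nonempty_discriminantGroup_restrict_orthogonal_model_addEquiv_zmod_prod_zmod (ht : 0 < t) {f d b a : ℤ}
    {D' T' : ℕ} (hf : f ≠ 0) (hd : d ≠ 0)
    {r : ((Fin m → Fin 8 → ℤ) × ((Fin (n + 2) → ℤ) × (Fin (n + 2) → ℤ))) × ℤ}
    (hr : (((LinearMap.BilinForm.pi fun _ : Fin m ↦ -e8Form).prod (hyperbolicSum (n + 2))).prod
      ((-(2 * t : ℤ)) • LinearMap.mul ℤ ℤ)) r r = 2 * d)
    (hfr : ∀ z, f ∣ (((LinearMap.BilinForm.pi fun _ : Fin m ↦ -e8Form).prod (hyperbolicSum (n + 2))).prod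
      ((-(2 * t : ℤ)) • LinearMap.mul ℤ ℤ)) r z)
    (hr' : ∃ r', (((LinearMap.BilinForm.pi fun _ : Fin m ↦ -e8Form).prod (hyperbolicSum (n + 2))).prod
      ((-(2 * t : ℤ)) • LinearMap.mul ℤ ℤ)) r r' = f)
    (hb : f ^ 2 * b = d + t * r.2 ^ 2) (ha : f * a = 2 * t * r.2) (hc : Int.gcd f r.2 = 1)
    (hD : f * D' = 2 * d) (hT : f * T' = 2 * t) (hw : Int.gcd f T' = 1) :
    Nonempty (((((LinearMap.BilinForm.pi fun _ : Fin m ↦ -e8Form).prod (hyperbolicSum (n + 2))).prod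
        ((-(2 * t : ℤ)) • LinearMap.mul ℤ ℤ)).restrict
      ((((LinearMap.BilinForm.pi fun _ : Fin m ↦ -e8Form).prod (hyperbolicSum (n + 2))).prod
        ((-(2 * t : ℤ)) • LinearMap.mul ℤ ℤ)).orthogonal (ℤ ∙ r))).discriminantGroup ≃+ ZMod D' × ZMod T') := by
  obtain ⟨-, -, hu⟩ := isSymm_isEven_isUnimodular_pi_neg_e8Form_prod_hyperbolicSum' m (n + 1)
  exact nonempty_discriminantGroup_addEquiv_zmod_prod_zmod_of_equivalent_prod_generalDivisorGram t ht hf hd hb ha hc hD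
    hT hw (restrict_orthogonal_model_equivalent_of_divisor m n t ht hf hr hfr hr' hb ha) hu

/-- **`D((h_d)^⊥) ≅ ℤ/(2d/f) × ℤ/(2t/f)` for `w = 1` and PRIMITIVE `h_d`** ("Let `h_d ∈ L_{2t}` be a primitive vector such
that `h_d² = 2d` and `div(h_d) = f`. Assume that `w = 1`": primitivity gives `(c, f) = 1`, "the coefficient `c` is coprime
to `f` because `h_d` is primitive"). [cite: GritsenkoHulekSankaran2010Symplectic, §4 Prop. 4.12 and its proof, Remark 4.15] -/
theorem nonempty_discriminantGroup_restrict_orthogonal_model_addEquiv_zmod_prod_zmod_of_primitive (ht : 0 < t)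
    {f d b a : ℤ} {D' T' : ℕ} (hf : f ≠ 0) (hd : d ≠ 0)
    {r : ((Fin m → Fin 8 → ℤ) × ((Fin (n + 2) → ℤ) × (Fin (n + 2) → ℤ))) × ℤ} (hr0 : r ≠ 0)
    (hsat : ∀ (k : ℤ) (w : ((Fin m → Fin 8 → ℤ) × ((Fin (n + 2) → ℤ) × (Fin (n + 2) → ℤ))) × ℤ), k ≠ 0 →
      k • w ∈ ℤ ∙ r → w ∈ ℤ ∙ r)
    (hr : (((LinearMap.BilinForm.pi fun _ : Fin m ↦ -e8Form).prod (hyperbolicSum (n + 2))).prod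
      ((-(2 * t : ℤ)) • LinearMap.mul ℤ ℤ)) r r = 2 * d)
    (hfr : ∀ z, f ∣ (((LinearMap.BilinForm.pi fun _ : Fin m ↦ -e8Form).prod (hyperbolicSum (n + 2))).prod
      ((-(2 * t : ℤ)) • LinearMap.mul ℤ ℤ)) r z)
    (hr' : ∃ r', (((LinearMap.BilinForm.pi fun _ : Fin m ↦ -e8Form).prod (hyperbolicSum (n + 2))).prod
      ((-(2 * t : ℤ)) • LinearMap.mul ℤ ℤ)) r r' = f)
    (hb : f ^ 2 * b = d + t * r.2 ^ 2) (ha : f * a = 2 * t * r.2) (hD : f * D' = 2 * d) (hT : f * T' = 2 * t)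
    (hw : Int.gcd f T' = 1) :
    Nonempty (((((LinearMap.BilinForm.pi fun _ : Fin m ↦ -e8Form).prod (hyperbolicSum (n + 2))).prod
        ((-(2 * t : ℤ)) • LinearMap.mul ℤ ℤ)).restrict
      ((((LinearMap.BilinForm.pi fun _ : Fin m ↦ -e8Form).prod (hyperbolicSum (n + 2))).prod
        ((-(2 * t : ℤ)) • LinearMap.mul ℤ ℤ)).orthogonal (ℤ ∙ r))).discriminantGroup ≃+ ZMod D' × ZMod T') := by
  obtain ⟨-, -, hu⟩ := isSymm_isEven_isUnimodular_pi_neg_e8Form_prod_hyperbolicSum' m (n + 2)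
  haveI : Module.IsTorsionFree ℤ ((Fin m → Fin 8 → ℤ) × ((Fin (n + 2) → ℤ) × (Fin (n + 2) → ℤ))) := inferInstance
  exact nonempty_discriminantGroup_restrict_orthogonal_model_addEquiv_zmod_prod_zmod m n t ht hf hd hr hfr hr' hb ha
    (gcd_snd_eq_one_of_primitive_of_forall_dvd t hu hr0 hsat hfr) hD hT hw

end Model

/-! ### §4 Remarks 4.14 and 4.15: when `w = 1`, when `D((h_d)^⊥)` is cyclic, and a scope note

"**Remark 4.14.** The condition `w = 1`, i.e., that `f` and `(2t/f, 2d/f)` are coprime, is valid for any `f` if `(2t, 2d)`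
is square free. In particular this condition is true for any vector `h_d` if `2t` is square free. **Remark 4.15.** The finite
group `[D]((h_d)^⊥_{L_{2t}})` is cyclic for any `h_d` with `div(h_d) = f` if `g₁ = (2t/f, 2d/f) = 1`. If `g₁ > 1` the
discriminant group is not cyclic, but it is the orthogonal sum of two cyclic groups if `w = 1`." (held text p. 13). The
first sentence of 4.15 and both sentences of 4.14 are proved below; the third clause of 4.15 is §2–§3 above; the middle
clause ("if `g₁ > 1` the discriminant group is not cyclic") is FALSE as printed — `t = 9`, `d = 27`, `f = 6` has `g₁ = 3` and
`D((h_27)^⊥_{L_18}) ≅ ℤ/27` — and is recorded as a counterexample, not restated. -/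

section Remarks

variable {N : Type*} {P₁ : Type*} [AddCommGroup N] [AddCommGroup P₁] {Λ : BilinForm ℤ N} {P : BilinForm ℤ P₁} (t : ℕ)

/-- **`(f, 2t/f) ∣ 2d/f`** for admissible data (`f²b = d + tc²`, `fD' = 2d`, `fT' = 2t`, `f ≠ 0`): `D' = 2fb − T'c²`. With
`(f, 2t/f) ∣ 2t/f` this is "`w = ((2t/f, 2d/f), f)` divides — in fact equals — `(f, 2t/f)`" (cf.
`gcd_gcd_eq_gcd_of_sq_dvd`). [cite: GritsenkoHulekSankaran2010Symplectic, §4 Prop. 4.6 (the invariants `w`, `g`) and Remark 4.15] -/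
theorem int_gcd_dvd_of_divisor_data {f b c d D' T' : ℤ} (hf : f ≠ 0) (hb : f ^ 2 * b = d + t * c ^ 2)
    (hD : f * D' = 2 * d) (hT : f * T' = 2 * t) : (Int.gcd f T' : ℤ) ∣ D' := by
  have hkey : D' = 2 * f * b - T' * c ^ 2 := by
    apply mul_left_cancel₀ hf
    linear_combination hD - 2 * hb + c ^ 2 * hT
  rw [hkey]
  exact dvd_sub (((Int.gcd_dvd_left f T').mul_left 2).mul_right b) ((Int.gcd_dvd_right f T').mul_right (c ^ 2))

/-- **`g₁ = (2d/f, 2t/f) = 1 ⟹ w = (f, 2t/f) = 1`** for admissible data — the hypothesis of the first sentence of Remark 4.15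
implies that of Prop. 4.12. [cite: GritsenkoHulekSankaran2010Symplectic, §4 Remark 4.15 and Prop. 4.12] -/
theorem int_gcd_eq_one_of_int_gcd_eq_one {f b c d D' T' : ℤ} (hf : f ≠ 0) (hb : f ^ 2 * b = d + t * c ^ 2)
    (hD : f * D' = 2 * d) (hT : f * T' = 2 * t) (hg : Int.gcd D' T' = 1) : Int.gcd f T' = 1 := by
  have h3 : (Int.gcd f T' : ℤ) ∣ (Int.gcd D' T' : ℤ) :=
    Int.dvd_coe_gcd (int_gcd_dvd_of_divisor_data t hf hb hD hT) (Int.gcd_dvd_right f T')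
  rw [hg] at h3
  exact Nat.dvd_one.1 (Int.natCast_dvd_natCast.1 h3)

/-- **Remark 4.14, second sentence: if `2t` is square free then `w = (f, 2t/f) = 1` for every divisor `f` of `2t`**
(`fT' = 2t`). [cite: GritsenkoHulekSankaran2010Symplectic, §4 Remark 4.14] -/
theorem int_gcd_eq_one_of_squarefree_two_mul {f : ℤ} {T' : ℕ} (hsq : Squarefree (2 * t)) (hT : f * T' = 2 * t) :
    Int.gcd f T' = 1 := by
  have h1 : f.natAbs * T' = 2 * t := by
    have h2 := congrArg Int.natAbs hT
    rw [Int.natAbs_mul, Int.natAbs_natCast] at h2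
    rw [h2]
    norm_cast
  rw [← h1] at hsq
  change Nat.gcd f.natAbs (T' : ℤ).natAbs = 1
  rw [Int.natAbs_natCast]
  exact (Nat.squarefree_mul_iff.1 hsq).1

/-- **Remark 4.14, first sentence: if `(2t, 2d)` is square free then `w = (f, 2t/f) = 1`** for admissible data
(`f²b = d + tc²`, `fD' = 2d`, `fT' = 2t`, `f ≠ 0`): `(f, T')² ∣ fT' = 2t` and `(f, T')² ∣ fD' = 2d` (§4 `int_gcd_dvd_of_divisor_data`).
[cite: GritsenkoHulekSankaran2010Symplectic, §4 Remark 4.14] -/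
theorem int_gcd_eq_one_of_squarefree_int_gcd {f b c d D' T' : ℤ} (hf : f ≠ 0) (hb : f ^ 2 * b = d + t * c ^ 2)
    (hD : f * D' = 2 * d) (hT : f * T' = 2 * t) (hsq : Squarefree (Int.gcd (2 * t) (2 * d))) : Int.gcd f T' = 1 := by
  set γ := Int.gcd f T' with hγ
  have h1 : ((γ * γ : ℕ) : ℤ) ∣ 2 * t := by
    rw [Nat.cast_mul, ← hT]
    exact mul_dvd_mul (Int.gcd_dvd_left f T') (Int.gcd_dvd_right f T')
  have h2 : ((γ * γ : ℕ) : ℤ) ∣ 2 * d := by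
    rw [Nat.cast_mul, ← hD]
    exact mul_dvd_mul (Int.gcd_dvd_left f T') (int_gcd_dvd_of_divisor_data t hf hb hD hT)
  exact Nat.isUnit_iff.1 (hsq γ (Int.natCast_dvd_natCast.1 (Int.dvd_coe_gcd h1 h2)))

/-- **Remark 4.15, first sentence, for `Λ ≅ P ⊕ L_B` with `P` unimodular: if `g₁ = (2t/f, 2d/f) = 1` then `A_Λ ≅ ℤ/(4dt/f²)`
is cyclic** (`w = 1` by `int_gcd_eq_one_of_int_gcd_eq_one`, then `ℤ/(2d/f) × ℤ/(2t/f) ≅ ℤ/((2d/f)(2t/f))` by the Chinese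
remainder theorem; `f²b = d + tc²`, `fa = 2tc`, `(f, c) = 1`, natural numbers `D', T'` with `fD' = 2d`, `fT' = 2t`,
`(D', T') = 1`, `f, d ≠ 0`, `t ≥ 1`). [cite: GritsenkoHulekSankaran2010Symplectic, §4 Remark 4.15] [cite: Nikulin1980, §1.3] -/
theorem nonempty_discriminantGroup_addEquiv_zmod_mul_of_equivalent_prod_generalDivisorGram (ht : 0 < t)
    {f b c a d : ℤ} {D' T' : ℕ} (hf : f ≠ 0) (hd : d ≠ 0) (hb : f ^ 2 * b = d + t * c ^ 2) (ha : f * a = 2 * t * c)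
    (hc : Int.gcd f c = 1) (hD : f * D' = 2 * d) (hT : f * T' = 2 * t) (hg : Nat.Coprime D' T')
    (h : Λ.Equivalent (P.prod (Matrix.toBilin' !![-(2 * b), a; a, -(2 * t : ℤ)]))) (hPu : P.IsUnimodular) :
    Nonempty (Λ.discriminantGroup ≃+ ZMod (D' * T')) := by
  have hw : Int.gcd f T' = 1 :=
    int_gcd_eq_one_of_int_gcd_eq_one t hf hb hD hT (by rw [Int.gcd_natCast_natCast]; exact hg)
  obtain ⟨e⟩ := nonempty_discriminantGroup_addEquiv_zmod_prod_zmod_of_equivalent_prod_generalDivisorGram t ht hf hd hb ha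
    hc hD hT hw h hPu
  exact ⟨e.trans (ZMod.chineseRemainder hg).toAddEquiv.symm⟩

end Remarks

section RemarksModel

variable (m n t : ℕ)

/-- **Remark 4.15, first sentence, in the models: `g₁ = (2t/f, 2d/f) = 1 ⟹ D((h_d)^⊥) ≅ ℤ/(4dt/f²)` is cyclic** (every
primitive `h` of `(E₈(−1)^{⊕m} ⊕ U^{⊕(n+2)}) ⊕ ℤ(−2t)` with `h² = 2d ≠ 0`, `(h, L) = fℤ`, `c = h.2` with `(f, c) = 1`,
`f²b = d + tc²`, `fa = 2tc`, `fD' = 2d`, `fT' = 2t`, `(D', T') = 1`). [cite: GritsenkoHulekSankaran2010Symplectic, §4 Remark 4.15] -/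
theorem nonempty_discriminantGroup_restrict_orthogonal_model_addEquiv_zmod_mul (ht : 0 < t) {f d b a : ℤ} {D' T' : ℕ}
    (hf : f ≠ 0) (hd : d ≠ 0)
    {r : ((Fin m → Fin 8 → ℤ) × ((Fin (n + 2) → ℤ) × (Fin (n + 2) → ℤ))) × ℤ}
    (hr : (((LinearMap.BilinForm.pi fun _ : Fin m ↦ -e8Form).prod (hyperbolicSum (n + 2))).prod
      ((-(2 * t : ℤ)) • LinearMap.mul ℤ ℤ)) r r = 2 * d)
    (hfr : ∀ z, f ∣ (((LinearMap.BilinForm.pi fun _ : Fin m ↦ -e8Form).prod (hyperbolicSum (n + 2))).prod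
      ((-(2 * t : ℤ)) • LinearMap.mul ℤ ℤ)) r z)
    (hr' : ∃ r', (((LinearMap.BilinForm.pi fun _ : Fin m ↦ -e8Form).prod (hyperbolicSum (n + 2))).prod
      ((-(2 * t : ℤ)) • LinearMap.mul ℤ ℤ)) r r' = f)
    (hb : f ^ 2 * b = d + t * r.2 ^ 2) (ha : f * a = 2 * t * r.2) (hc : Int.gcd f r.2 = 1)
    (hD : f * D' = 2 * d) (hT : f * T' = 2 * t) (hg : Nat.Coprime D' T') :
    Nonempty (((((LinearMap.BilinForm.pi fun _ : Fin m ↦ -e8Form).prod (hyperbolicSum (n + 2))).prod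
        ((-(2 * t : ℤ)) • LinearMap.mul ℤ ℤ)).restrict
      ((((LinearMap.BilinForm.pi fun _ : Fin m ↦ -e8Form).prod (hyperbolicSum (n + 2))).prod
        ((-(2 * t : ℤ)) • LinearMap.mul ℤ ℤ)).orthogonal (ℤ ∙ r))).discriminantGroup ≃+ ZMod (D' * T')) := by
  obtain ⟨-, -, hu⟩ := isSymm_isEven_isUnimodular_pi_neg_e8Form_prod_hyperbolicSum' m (n + 1)
  exact nonempty_discriminantGroup_addEquiv_zmod_mul_of_equivalent_prod_generalDivisorGram t ht hf hd hb ha hc hD hT hg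
    (restrict_orthogonal_model_equivalent_of_divisor m n t ht hf hr hfr hr' hb ha) hu

end RemarksModel

section ScopeNote

/-- **`[ε₁]` has order `27` in `D(L_B)` for `B = (−2, 3; 3, −18)`** (`t = 9`, `b = 1`, `a = 3`: `mε₁ ∈ i_B(L_B)` iff
`m = 3x − 18y` with `−2x + 3y = 0`, iff `27 ∣ m`). [cite: GritsenkoHulekSankaran2010Symplectic, §4 Remark 4.15 (scope of "if `g₁ > 1` the discriminant group is not cyclic")] -/
theorem zsmul_mk_proj_one_generalDivisorGram_nine_eq_zero_iff (m : ℤ) :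
    m • (Submodule.Quotient.mk (LinearMap.proj 1 : Module.Dual ℤ (Fin 2 → ℤ)) :
        (Matrix.toBilin' !![-(2 * 1), 3; 3, -(2 * (9 : ℕ) : ℤ)]).discriminantGroup) = 0 ↔ 27 ∣ m := by
  change Submodule.Quotient.mk (m • (LinearMap.proj 1 : Module.Dual ℤ (Fin 2 → ℤ))) = 0 ↔ _
  rw [Submodule.Quotient.mk_eq_zero,
    show m • (LinearMap.proj 1 : Module.Dual ℤ (Fin 2 → ℤ)) =
      (0 : ℤ) • (LinearMap.proj 0 : Module.Dual ℤ (Fin 2 → ℤ)) + m • (LinearMap.proj 1 : Module.Dual ℤ (Fin 2 → ℤ)) by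
        rw [zero_smul, zero_add],
    smul_proj_add_smul_proj_mem_range_iff]
  constructor
  · rintro ⟨x, y, h1, h2⟩
    push_cast at h2
    omega
  · rintro ⟨k, rfl⟩
    exact ⟨-(3 * k), -(2 * k), by ring, by push_cast; ring⟩

/-- **Scope note on Remark 4.15, made precise: `D(L_B) ≅ ℤ/27` is CYCLIC for `B = (−2, 3; 3, −18)`**, the Prop. 4.6 (iv) form
of `t = 9`, `d = 27`, `f = 6` (`c = 1`, `b = 1`, `a = 3`: `6²·1 = 27 + 9·1²`, `6·3 = 2·9·1`), although
`g₁ = (2t/f, 2d/f) = (3, 9) = 3 > 1` (and `w = 3`): `|D(L_B)| = 27` and `[ε₁]` has order `27`. So the printed "if `g₁ > 1` the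
discriminant group is not cyclic" does not hold in this generality; the tree keeps the two correct clauses (§4 above, §2–§3).
[cite: GritsenkoHulekSankaran2010Symplectic, §4 Remark 4.15] -/
theorem nonempty_discriminantGroup_generalDivisorGram_nine_addEquiv_zmod :
    Nonempty ((Matrix.toBilin' !![-(2 * 1), 3; 3, -(2 * (9 : ℕ) : ℤ)]).discriminantGroup ≃+ ZMod 27) := by
  have hcard : Nat.card (Matrix.toBilin' !![-(2 * 1), 3; 3, -(2 * (9 : ℕ) : ℤ)]).discriminantGroup = 27 := by
    rw [natCard_discriminantGroup_generalDivisorGram 9 (by norm_num) (f := 6) (c := 1) (d := 27) (D' := 9) (T' := 3)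
      (by norm_num) (by norm_num) (by norm_num) (by norm_num) (by norm_num) (by norm_num)]
    rfl
  haveI : Finite (Matrix.toBilin' !![-(2 * 1), 3; 3, -(2 * (9 : ℕ) : ℤ)]).discriminantGroup :=
    Nat.finite_of_card_ne_zero (by rw [hcard]; norm_num)
  have h27 : (27 : ℤ) • (Submodule.Quotient.mk (LinearMap.proj 1 : Module.Dual ℤ (Fin 2 → ℤ)) :
      (Matrix.toBilin' !![-(2 * 1), 3; 3, -(2 * (9 : ℕ) : ℤ)]).discriminantGroup) = 0 :=
    (zsmul_mk_proj_one_generalDivisorGram_nine_eq_zero_iff 27).2 dvd_rfl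
  set ψ : ZMod 27 →+ (Matrix.toBilin' !![-(2 * 1), 3; 3, -(2 * (9 : ℕ) : ℤ)]).discriminantGroup :=
    ZMod.lift 27 ⟨zmultiplesHom _ (Submodule.Quotient.mk (LinearMap.proj 1 : Module.Dual ℤ (Fin 2 → ℤ))),
      by rw [zmultiplesHom_apply]; exact h27⟩ with hψ
  have hψ_apply : ∀ k : ℤ, ψ (k : ZMod 27) = k • Submodule.Quotient.mk (LinearMap.proj 1 : Module.Dual ℤ (Fin 2 → ℤ)) :=
    fun k ↦ by rw [hψ, ZMod.lift_coe]; rfl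
  have hinj : Function.Injective ψ := by
    refine (injective_iff_map_eq_zero ψ).2 fun x hx ↦ ?_
    have h1 : ψ ((x.val : ℤ) : ZMod 27) = 0 := by rwa [Int.cast_natCast, ZMod.natCast_zmod_val]
    rw [hψ_apply, zsmul_mk_proj_one_generalDivisorGram_nine_eq_zero_iff] at h1
    have h2 : ((x.val : ℕ) : ZMod 27) = 0 := (ZMod.natCast_eq_zero_iff _ _).2 (Int.natCast_dvd_natCast.1 h1)
    rwa [ZMod.natCast_zmod_val] at h2
  have hle : Nat.card (Matrix.toBilin' !![-(2 * 1), 3; 3, -(2 * (9 : ℕ) : ℤ)]).discriminantGroup ≤ Nat.card (ZMod 27) := by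
    rw [hcard, Nat.card_zmod]
  exact ⟨(AddEquiv.ofBijective ψ (hinj.bijective_of_nat_card_le hle)).symm⟩

/-- **The counterexample inside `L_18 = 2E₈(−1) ⊕ 3U ⊕ ⟨−18⟩`: a primitive `h_27` with `h_27² = 54`, `div(h_27) = 6`
(so `g₁ = (3, 9) = 3 > 1`, `w = 3`) and `D((h_27)^⊥) ≅ ℤ/27` cyclic.** Existence of `h_27` with `l_t`-coordinate `c = 1`:
Prop. 4.6 (`(1, 6) = 1`, `6 ∣ 18`, `36 ∣ 27 + 9`); its complement is `(2E₈(−1) ⊕ 2U) ⊕ L_B` with `B = (−2, 3; 3, −18)`.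
[cite: GritsenkoHulekSankaran2010Symplectic, §4 Remark 4.15 and Prop. 4.6] -/
theorem exists_divisor_six_discriminantGroup_restrict_orthogonal_addEquiv_zmod_twentySeven :
    ∃ r : ((Fin 2 → Fin 8 → ℤ) × ((Fin 3 → ℤ) × (Fin 3 → ℤ))) × ℤ,
      (((LinearMap.BilinForm.pi fun _ : Fin 2 ↦ -e8Form).prod (hyperbolicSum 3)).prod
        ((-(2 * (9 : ℕ) : ℤ)) • LinearMap.mul ℤ ℤ)) r r = 2 * 27 ∧ r ≠ 0 ∧
      (∀ (k : ℤ) (w : ((Fin 2 → Fin 8 → ℤ) × ((Fin 3 → ℤ) × (Fin 3 → ℤ))) × ℤ), k ≠ 0 → k • w ∈ ℤ ∙ r → w ∈ ℤ ∙ r) ∧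
      (∀ z, (6 : ℤ) ∣ (((LinearMap.BilinForm.pi fun _ : Fin 2 ↦ -e8Form).prod (hyperbolicSum 3)).prod
        ((-(2 * (9 : ℕ) : ℤ)) • LinearMap.mul ℤ ℤ)) r z) ∧
      (∃ r', (((LinearMap.BilinForm.pi fun _ : Fin 2 ↦ -e8Form).prod (hyperbolicSum 3)).prod
        ((-(2 * (9 : ℕ) : ℤ)) • LinearMap.mul ℤ ℤ)) r r' = 6) ∧
      Nonempty ((((((LinearMap.BilinForm.pi fun _ : Fin 2 ↦ -e8Form).prod (hyperbolicSum 3)).prod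
        ((-(2 * (9 : ℕ) : ℤ)) • LinearMap.mul ℤ ℤ))).restrict
        (((((LinearMap.BilinForm.pi fun _ : Fin 2 ↦ -e8Form).prod (hyperbolicSum 3)).prod
        ((-(2 * (9 : ℕ) : ℤ)) • LinearMap.mul ℤ ℤ))).orthogonal (ℤ ∙ r))).discriminantGroup ≃+ ZMod 27) := by
  obtain ⟨-, he, hu⟩ := isSymm_isEven_isUnimodular_pi_neg_e8Form_prod_hyperbolicSum' 2 (1 + 2)
  obtain ⟨r, r', hr2, hr, hr0, hsat, hfr, hr'⟩ := (exists_primitive_apply_self_eq_snd_eq_iff 9 hu he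
    (twoHyperbolicPairs_pi_neg_e8Form_prod_hyperbolicSum_add_two 2 1) 6 27 1).2 ⟨by norm_num, by norm_num, by norm_num⟩
  refine ⟨r, hr, hr0, hsat, hfr, ⟨r', hr'⟩, ?_⟩
  obtain ⟨φ⟩ := nonempty_discriminantGroup_restrict_orthogonal_model_linearEquiv_of_divisor 2 1 9 (by norm_num) (f := 6)
    (d := 27) (b := 1) (a := 3) (by norm_num) hr hfr ⟨r', hr'⟩ (by rw [hr2]; norm_num) (by rw [hr2]; norm_num)
  obtain ⟨e⟩ := nonempty_discriminantGroup_generalDivisorGram_nine_addEquiv_zmod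
  exact ⟨φ.toAddEquiv.trans e⟩

end ScopeNote

end Literature.Topology.FourManifolds
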